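/-
Copyright: the b2b-balaban T⁴-continuum CRUX team, row NE7b OWNER lineage `t4-ne7b-p1` (gen 130). Project licence.
-/
import Mathlib.Analysis.InnerProductSpace.PiL2
import Mathlib.Analysis.Calculus.MeanValue
import Mathlib.Algebra.QuadraticDiscriminant

/-!
# DIAGONAL BOUNDS ON A SYMMETRIC BILINEAR FORM CONTROL IT OFF THE DIAGONAL: for symmetric bilinear `H, Q` on a real normed space with
# `Q ≥ 0` on the diagonal and `−a·Q(v,v) ≤ H(v,v) ≤ b·Q(v,v)` (`a ≥ 0`, `a + b ≥ 0`),
#   `|H(h,k)| ≤ (2a+b)·√Q(h,h)·√Q(k,k)`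
# — Cauchy–Schwarz for the positive forms `H + aQ` and `Q`; plus the scalar mean-value letter on `[0,1]` and the road's gauge
# `Q_b = Σ_{p∈C}Σ_{x∈cell p}proj_x⊗proj_x` as a bilinear map (row NE7b, node U5c; Mathlib only; [folklore])

Cell `pub-balaban`, sub-cell `t4`, spine estimate NE7b (`T4WeightBudget.RelWeightBound`; the cell's OWN estimate — NOT PRINTED in
[Bałaban 1983–89], NOT PROVED).  Crux-route work under `Spine/NE7b/` by the row OWNER (`t4-ne7b-p1` gen 130, file (322a)) under FREEZE
(0)'s crux-prover clause, on § [NE7bP1-G129-HANDOFF] NEXT (ii) (the algebra the second-order re-entry of the next remainder consumes: the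
two LETTERS of (316)∕(318) bound the Hessian of (319) on the diagonal only); NOTHING of Bałaban's is named as a Lean object, valued or
asserted; no `T4Continuum/Support` leaf typed; no `def`, no notation; zero `sorry`.  Mathlib only (`discrim_le_zero`, `Real.sqrt_le_sqrt`,
`Real.mul_self_sqrt`, `norm_image_sub_le_of_norm_deriv_le_segment_01'`, `PiLp.proj_apply`).

WHAT IS PROVED ([folklore]; `E` a real normed space; `P, H, Q : E →L[ℝ] E →L[ℝ] ℝ`):
* §1 `sq_apply_le_of_psd_symm` (Cauchy–Schwarz `(Phk)² ≤ Phh·Pkk` for `P` symmetric with `P ≥ 0` on the diagonal: the discriminant of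
  `t ↦ P(h+tk, h+tk) ≥ 0`), `abs_apply_le_sqrt_of_psd_symm` (`|Phk| ≤ √Phh·√Pkk`), **`abs_apply_le_of_diag_bounds`** (displayed above),
  `abs_sub_le_of_hasDerivAt_le` (`|g(1) − g(0)| ≤ K` when `|g'| ≤ K` on `[0,1)`);
* §2 `cellSqBil_apply` (`Q_b h k = Σ_{p,x}h_xk_x`), `cellSqBil_apply_self` (`Q_b v v = Σ_{p,x}v_x²`); §3 toy.

HONEST (what this is NOT).  Linear algebra and one-variable calculus only; nothing of Bałaban's asserted.  BY-NAME EFFECT ON THE WALL: NONE.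
NE7b NOT PRINTED ∕ NOT PROVED; spine PROVED 0∕9; rung (B)+1 — the programme's measures remain FINITE-torus statements; NOT the mass gap,
NOT Clay.  HONEST DEPENDENCY: continuum YM on T⁴ ⇐ BetaPertH ∧ nine spine estimates (0∕9 proved); BetaPertH ⇐ (D1) ∧ (D4) ∧ CAP+tail;
G-an2-4 gates asym, D1 and NE2∕3∕4.
-/

set_option autoImplicit false
set_option maxSynthPendingDepth 2

noncomputable section

namespace Summit.QuantumFields.BalabanUV.T4Continuum.NE7b.SupSymmetricFormBounds

open Finset Real Set
open scoped BigOperators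

variable {ι : Type} {V : Type*}

/-! ## §1. Abstract: Cauchy–Schwarz for a positive symmetric bilinear form; off-diagonal from diagonal bounds; mean value -/

section Abstract

variable {E : Type*} [NormedAddCommGroup E] [NormedSpace ℝ E]

/-- **CAUCHY–SCHWARZ** for a symmetric positive bilinear form `P : E →L E →L ℝ`: `(Phk)² ≤ Phh·Pkk` (discriminant of
`t ↦ P(h+tk)(h+tk) ≥ 0`). [folklore] -/
theorem sq_apply_le_of_psd_symm (P : E →L[ℝ] E →L[ℝ] ℝ) (hsymm : ∀ h k, P h k = P k h) (hpsd : ∀ v, 0 ≤ P v v) (h k : E) :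
    (P h k) ^ 2 ≤ P h h * P k k := by
  have hq : ∀ t : ℝ, 0 ≤ P k k * (t * t) + 2 * P h k * t + P h h := fun t => by
    have h0 := hpsd (h + t • k)
    have e : P (h + t • k) (h + t • k) = P k k * (t * t) + 2 * P h k * t + P h h := by
      simp only [map_add, map_smul, _root_.add_apply, _root_.smul_apply, smul_eq_mul]
      rw [hsymm k h]
      ring
    rw [e] at h0
    exact h0
  have hd := discrim_le_zero hq
  rw [discrim] at hd
  nlinarith [hd]

/-- `|Phk| ≤ √(Phh)·√(Pkk)` for a symmetric positive bilinear form. [folklore] -/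
theorem abs_apply_le_sqrt_of_psd_symm (P : E →L[ℝ] E →L[ℝ] ℝ) (hsymm : ∀ h k, P h k = P k h) (hpsd : ∀ v, 0 ≤ P v v) (h k : E) :
    |P h k| ≤ Real.sqrt (P h h) * Real.sqrt (P k k) := by
  rw [← Real.sqrt_mul (hpsd h), ← Real.sqrt_sq_eq_abs]
  exact Real.sqrt_le_sqrt (sq_apply_le_of_psd_symm P hsymm hpsd h k)

/-- **OFF-DIAGONAL FROM DIAGONAL BOUNDS**: `H, Q` symmetric bilinear, `Q ≥ 0` on the diagonal, `0 ≤ a`, `0 ≤ a + b`, and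
`−a·Qvv ≤ Hvv ≤ b·Qvv` for all `v` ⟹ `|Hhk| ≤ (2a+b)·√(Qhh)·√(Qkk)` (Cauchy–Schwarz for the positive forms `H + aQ` and `Q`). [folklore] -/
theorem abs_apply_le_of_diag_bounds (H Q : E →L[ℝ] E →L[ℝ] ℝ) (hHs : ∀ h k, H h k = H k h) (hQs : ∀ h k, Q h k = Q k h)
    (hQ : ∀ v, 0 ≤ Q v v) {a b : ℝ} (ha : 0 ≤ a) (hab : 0 ≤ a + b) (hlo : ∀ v, -(a * Q v v) ≤ H v v) (hhi : ∀ v, H v v ≤ b * Q v v)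
    (h k : E) : |H h k| ≤ (2 * a + b) * Real.sqrt (Q h h) * Real.sqrt (Q k k) := by
  -- the shifted form `P = H + a•Q` is positive and symmetric, with diagonal `≤ (a+b)Q`
  have hPs : ∀ h k, (H + a • Q) h k = (H + a • Q) k h := fun h k => by
    simp only [_root_.add_apply, _root_.smul_apply, smul_eq_mul, hHs h k, hQs h k]
  have hPp : ∀ v, 0 ≤ (H + a • Q) v v := fun v => by
    simp only [_root_.add_apply, _root_.smul_apply, smul_eq_mul]
    linarith [hlo v]
  have hPle : ∀ v, (H + a • Q) v v ≤ (a + b) * Q v v := fun v => by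
    simp only [_root_.add_apply, _root_.smul_apply, smul_eq_mul]
    linarith [hhi v]
  have hsq : ∀ v, Real.sqrt ((H + a • Q) v v) ≤ Real.sqrt (a + b) * Real.sqrt (Q v v) := fun v => by
    rw [← Real.sqrt_mul hab]
    exact Real.sqrt_le_sqrt (hPle v)
  have hP : |(H + a • Q) h k| ≤ (a + b) * (Real.sqrt (Q h h) * Real.sqrt (Q k k)) :=
    calc |(H + a • Q) h k| ≤ Real.sqrt ((H + a • Q) h h) * Real.sqrt ((H + a • Q) k k) :=
          abs_apply_le_sqrt_of_psd_symm _ hPs hPp h k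
      _ ≤ (Real.sqrt (a + b) * Real.sqrt (Q h h)) * (Real.sqrt (a + b) * Real.sqrt (Q k k)) :=
          mul_le_mul (hsq h) (hsq k) (Real.sqrt_nonneg _) (by positivity)
      _ = (a + b) * (Real.sqrt (Q h h) * Real.sqrt (Q k k)) := by
          rw [mul_mul_mul_comm, Real.mul_self_sqrt hab]
  have hQcs : |Q h k| ≤ Real.sqrt (Q h h) * Real.sqrt (Q k k) := abs_apply_le_sqrt_of_psd_symm Q hQs hQ h k
  have haQ : a * |Q h k| ≤ a * (Real.sqrt (Q h h) * Real.sqrt (Q k k)) := mul_le_mul_of_nonneg_left hQcs ha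
  have e : H h k = (H + a • Q) h k - a * Q h k := by
    simp only [_root_.add_apply, _root_.smul_apply, smul_eq_mul]
    ring
  rw [e]
  calc |(H + a • Q) h k - a * Q h k| ≤ |(H + a • Q) h k| + |a * Q h k| := abs_sub _ _
    _ = |(H + a • Q) h k| + a * |Q h k| := by rw [abs_mul, abs_of_nonneg ha]
    _ ≤ (2 * a + b) * Real.sqrt (Q h h) * Real.sqrt (Q k k) := by linarith

omit [NormedSpace ℝ E] in
/-- **MEAN VALUE ON `[0,1]`** (scalar): `g` with derivative `g' t` at every `t` and `|g' t| ≤ K` on `[0,1)` ⟹ `|g 1 − g 0| ≤ K`. [folklore] -/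
theorem abs_sub_le_of_hasDerivAt_le {g g' : ℝ → ℝ} (hg : ∀ t, HasDerivAt g (g' t) t) {K : ℝ} (hK : ∀ t ∈ Ico (0 : ℝ) 1, |g' t| ≤ K) :
    |g 1 - g 0| ≤ K := by
  have h := norm_image_sub_le_of_norm_deriv_le_segment_01' (fun t _ => (hg t).hasDerivWithinAt) fun t ht => by
    rw [Real.norm_eq_abs]
    exact hK t ht
  rwa [Real.norm_eq_abs] at h

end Abstract

/-! ## §2. The gauge as a bilinear map -/

/-- The bilinear gauge `Q_b = Σ_{p∈C}Σ_{x∈cell p}proj_x⊗proj_x` applied: `Q_b h k = Σ h_xk_x`. [folklore] -/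
theorem cellSqBil_apply (cell : V → Finset ι) (C : Finset V) (h k : EuclideanSpace ℝ ι) :
    (∑ p ∈ C, ∑ x ∈ cell p, (EuclideanSpace.proj x : EuclideanSpace ℝ ι →L[ℝ] ℝ).smulRight
        (EuclideanSpace.proj x : EuclideanSpace ℝ ι →L[ℝ] ℝ)) h k = ∑ p ∈ C, ∑ x ∈ cell p, h x * k x := by
  simp only [_root_.sum_apply, ContinuousLinearMap.smulRight_apply, _root_.smul_apply, PiLp.proj_apply, smul_eq_mul]

/-- On the diagonal the bilinear gauge is the gauge: `Q_b v v = Σ v_x²`. [folklore] -/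
theorem cellSqBil_apply_self (cell : V → Finset ι) (C : Finset V) (v : EuclideanSpace ℝ ι) :
    (∑ p ∈ C, ∑ x ∈ cell p, (EuclideanSpace.proj x : EuclideanSpace ℝ ι →L[ℝ] ℝ).smulRight
        (EuclideanSpace.proj x : EuclideanSpace ℝ ι →L[ℝ] ℝ)) v v = ∑ p ∈ C, ∑ x ∈ cell p, v x ^ 2 := by
  rw [cellSqBil_apply]
  exact sum_congr rfl fun p _ => sum_congr rfl fun x _ => by ring

/-! ## §3. Toy -/

/-- Toy (§1): Cauchy–Schwarz for the ZERO form reads `0 ≤ 0`. -/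
example (h k : EuclideanSpace ℝ (Fin 2)) :
    ((0 : EuclideanSpace ℝ (Fin 2) →L[ℝ] EuclideanSpace ℝ (Fin 2) →L[ℝ] ℝ) h k) ^ 2 ≤
      (0 : EuclideanSpace ℝ (Fin 2) →L[ℝ] EuclideanSpace ℝ (Fin 2) →L[ℝ] ℝ) h h *
        (0 : EuclideanSpace ℝ (Fin 2) →L[ℝ] EuclideanSpace ℝ (Fin 2) →L[ℝ] ℝ) k k :=
  sq_apply_le_of_psd_symm 0 (fun _ _ => rfl) (fun _ => le_rfl) h k

end Summit.QuantumFields.BalabanUV.T4Continuum.NE7b.SupSymmetricFormBounds
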